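import Summits.CriticalPhenomena.PercolationContinuityZ3.Theorems.PercNearOneGluingNoHeavyLowerTailAntitheticBoundaryCount
import Mathlib.Algebra.BigOperators.Group.Finset.Piecewise
import Mathlib.Algebra.Order.BigOperators.Group.Finset
import HarnessLib

/-!
# `NoHeavyLowerTail` (stmt-CriticalPhenomena-4575) — antithetic cluster pairs: LEMMA Λ (the MIX–OS pairing that closes CONJECTURE Δ2 on ears),
# the abstract BOUNDARY COUNT, part 1: interval lemmas, cross-cancellation, dichotomy (prim-hp-2 gen 45; HOME/MEMO-gen45.md §1,
# HOME/THEOREM-OS-augmentation.md §6–§7)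

Support file (`--supports stmt-CriticalPhenomena-4575`, hull-port prover `prim-hp-2`, gen 45).  No definitions, no named facts, no sorries.

PURE COMBINATORICS (no graphs).  LEMMA Λ (THEOREM-OS §6): on the cycle `v 0 = s, …, v (n−1)` with a marker set `P` at a vertex `b`, NESTED marker
sets `A ⊆ A⁺` at a vertex `a` and the lifts `ℓ_P, ℓ_A, ℓ⁺ = ℓ_{P, A⁺}` ("attach the markers at the vertices seen by the cluster"),
`Λ := Σ_{T ∈ D(R′)} [Δ(ℓ_P C, ℓ_A C′) + Δ(ℓ⁺ C, C′)] ≥ 0`.  Its boundary layer consists of four families of arc / full terms (`⁺`-lifted,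
`P`-lifted, `A`-lifted, plain) and, at every position `i ∈ [1, n−1]` allowed by `R′`, FOUR one-change terms.  For an upper set `U` the
memberships of the (lifted) runs are THRESHOLD conditions with clockwise thresholds `ap ≤ aP, aA ≤ a` (chains `ℓ⁺P_i ⊇ ℓ_P P_i, ℓ_A P_i ⊇ P_i`)
and counter-clockwise thresholds `cp ≤ cP, cA ≤ c`; for `W`: `bp ≤ bP, bA ≤ b` and `dp ≤ dP, dA ≤ d`.  THE ONLY HYPOTHESES are these sandwich
inequalities and `ap, cp, bp, dp ≥ 1`.  Writing a one-change term as `(X, X′)` with `X` a (lifted) clockwise run — thresholds `u` (`U`), `v` (`W`) —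
and `X′` a (lifted) counter-clockwise run — thresholds `w` (`U`), `z` (`W`) — the four families `(u,w | v,z)` are
`1 = (ap,c | bp,d)` [`(ℓ⁺P_i, Q_{n−i})`], `2 = (a,cp | b,dp)` [`(P_i, ℓ⁺Q_{n−i})`, members exchanged], `3 = (aP,cA | bP,dA)` [`(ℓ_P P_i, ℓ_A Q_{n−i})`],
`4 = (aA,cP | bA,dP)` [`(ℓ_A P_i, ℓ_P Q_{n−i})`, exchanged]; the membership pattern `(X∈U, X′∈U, X∈W, X′∈W)` is BAD of kind a `(1,0,0,1)` or of
kind b `(0,1,1,0)` (indicator value `−1`) and GOOD for `(1,0,1,0)`, `(0,1,0,1)` (value `+1`).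
THIS FILE: (1) `four_interval` — under the sandwich order the four "crossed" interval lengths (where the kind-a, resp. kind-b, bad positions live)
are dominated by the four "straight" lengths (paid by the arcs), a bubble sort of convexity swaps; (2) the CROSS-CANCELLATION lemmas `la*`,
`lb*`, `lc*`, `ld*` (one `omega` step each: a bad term anywhere forces good partner terms here); (3) `dichotomy` — either at EVERY position the
kind-a bad terms are outnumbered by the good terms there, or at every position the kind-b ones are.  Part 2 (file …AntitheticLamCount) sums up.
Machine-checked before formalisation: the count exhaustively over all thresholds for `n
    ≤ 6` (1.48·10⁹ pairs at `n = 6`; HOME/code/gen44/kit/abslam_np,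
kit j195193) and every position lemma over all `6⁴ × 6⁴` abstract down-set configurations (HOME/code/gen45/lab/abstract_check.py, lemcheck2.py).
[cite: VandenbergHaggstromKahn2005, §1 p. 3 (open cluster `C_s`)]
-/

namespace Summit.CriticalPhenomena.PercolationContinuityZ3.Theorems

namespace Antithetic

namespace LamCount

section Intervals

variable {n u w v z : ℕ}

/-- A kind-a bad position of the family `(u,w | v,z)` lies in `[u, n − z]`. [this work] -/
theorem card_badA_le (I : Finset ℕ) (hz : 1 ≤ z) :
    (I.filter fun i => u ≤ i ∧ ¬ w ≤ n - i ∧ ¬ v ≤ i ∧ z ≤ n - i).card ≤ n - z + 1 - u := by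
  have h : (I.filter fun i => u ≤ i ∧ ¬ w ≤ n - i ∧ ¬ v ≤ i ∧ z ≤ n - i) ⊆ Finset.Icc u (n - z) := fun i hi => by
    rw [Finset.mem_filter] at hi; rw [Finset.mem_Icc]; omega
  simpa only [Nat.card_Icc] using Finset.card_le_card h

/-- A kind-b bad position of the family `(u,w | v,z)` lies in `[v, n − w]`. [this work] -/
theorem card_badB_le (I : Finset ℕ) (hw : 1 ≤ w) :
    (I.filter fun i => ¬ u ≤ i ∧ w ≤ n - i ∧ v ≤ i ∧ ¬ z ≤ n - i).card ≤ n - w + 1 - v := by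
  have h : (I.filter fun i => ¬ u ≤ i ∧ w ≤ n - i ∧ v ≤ i ∧ ¬ z ≤ n - i) ⊆ Finset.Icc v (n - w) := fun i hi => by
    rw [Finset.mem_filter] at hi; rw [Finset.mem_Icc]; omega
  simpa only [Nat.card_Icc] using Finset.card_le_card h

/-- Convexity swap for interval lengths: giving the larger right end to the smaller left end does not decrease the total. [folklore] -/
theorem len_swap {u u' r r' : ℕ} (hu : u ≤ u') (hr : r' ≤ r) : (r' + 1 - u) + (r + 1 - u') ≤ (r + 1 - u) + (r' + 1 - u') := by
  omega

/-- **Four-interval lemma** (for any length function `L` with the swap property): left ends `u0 ≤ u1, u3 ≤ u2`, right ends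
`r2 ≤ r1, r3 ≤ r0` — the crossed matching `[u0,r2], [u2,r0], [u1,r3], [u3,r1]` has total length at most the straight one. [this work] -/
theorem four_interval (L : ℕ → ℕ → ℕ) (hL : ∀ u u' r r', u ≤ u' → r' ≤ r → L u r' + L u' r ≤ L u r + L u' r')
    {u0 u1 u2 u3 r0 r1 r2 r3 : ℕ} (h01 : u0 ≤ u1) (h12 : u1 ≤ u2) (h03 : u0 ≤ u3) (h32 : u3 ≤ u2)
    (k21 : r2 ≤ r1) (k10 : r1 ≤ r0) (k23 : r2 ≤ r3) (k30 : r3 ≤ r0) :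
    L u0 r2 + L u2 r0 + L u1 r3 + L u3 r1 ≤ L u0 r0 + L u1 r1 + L u3 r3 + L u2 r2 := by
  rcases le_total u1 u3 with h13 | h31
  · rcases le_total r3 r1 with k31 | k13
    · have s1 := hL _ _ _ _ (le_trans h01 h12) (le_trans k21 k10)
      have s2 := hL _ _ _ _ h13 k31
      omega
    · have s1 := hL _ _ _ _ h03 k21
      have s2 := hL _ _ _ _ h01 k13
      have s3 := hL _ _ _ _ (le_trans h01 h12) k30
      have s4 := hL _ _ _ _ h32 k23
      omega
  · rcases le_total r1 r3 with k13 | k31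
    · have s1 := hL _ _ _ _ (le_trans h01 h12) (le_trans k21 k10)
      have s2 := hL _ _ _ _ h31 k13
      omega
    · have s1 := hL _ _ _ _ h01 k23
      have s2 := hL _ _ _ _ h03 k31
      have s3 := hL _ _ _ _ (le_trans h03 h32) k10
      have s4 := hL _ _ _ _ h12 k21
      omega

/-- Summing four pointwise indicator inequalities over `I`. [folklore] -/
theorem sum4_le (I : Finset ℕ) (P1 P2 P3 P4 Q1 Q2 Q3 Q4 : ℕ → Prop) [DecidablePred P1] [DecidablePred P2] [DecidablePred P3]
    [DecidablePred P4] [DecidablePred Q1] [DecidablePred Q2] [DecidablePred Q3] [DecidablePred Q4]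
    (h : ∀ i, (if P1 i then 1 else 0) + (if P2 i then 1 else 0) + (if P3 i then 1 else 0) + (if P4 i then 1 else 0) ≤
      (if Q1 i then 1 else 0) + (if Q2 i then 1 else 0) + (if Q3 i then 1 else 0) + (if Q4 i then 1 else 0)) :
    (I.filter P1).card + (I.filter P2).card + (I.filter P3).card + (I.filter P4).card ≤
      (I.filter Q1).card + (I.filter Q2).card + (I.filter Q3).card + (I.filter Q4).card := by
  simp only [Finset.card_filter, ← Finset.sum_add_distrib]
  exact Finset.sum_le_sum fun i _ => h i

end Intervals

section Main

variable {n ap aP aA a cp cP cA c bp bP bA b dp dP dA d : ℕ}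

/-- A kind-b bad term of family 3 excludes kind-a bad terms of family 3 everywhere. [this work] -/
theorem la1 {i k : ℕ} (hk : (¬ aP ≤ k ∧ cA ≤ n - k ∧ bP ≤ k ∧ ¬ dA ≤ n - k)) : ¬ (aP ≤ i ∧ ¬ cA ≤ n - i ∧ ¬ bP ≤ i ∧ dA ≤ n - i) := by omega

/-- Family-3 kind-b witness: a kind-a bad term of family 1 comes with good terms of families 3 and 2. [this work] -/
theorem la2 {i k : ℕ} (hs : (ap ≤ aP ∧ aP ≤ a ∧ ap ≤ aA ∧ aA ≤ a ∧ cp ≤ cP ∧ cP ≤ c ∧ cp ≤ cA ∧ cA ≤ c ∧ bp ≤ bP ∧ bP ≤ b ∧ bp ≤ bA ∧ bA ≤ b ∧ dp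
    ≤ dP ∧ dP ≤ d ∧ dp ≤ dA ∧ dA ≤ d)) (hk : (¬ aP ≤ k ∧ cA ≤ n - k ∧ bP ≤ k ∧ ¬ dA ≤ n - k)) (hi : (ap ≤ i ∧ ¬ c ≤ n - i ∧ ¬ bp ≤ i ∧ d
    ≤ n - i)) : ((aP ≤ i ∧ ¬ cA ≤ n - i ∧ bP ≤ i ∧ ¬ dA ≤ n - i) ∨ (¬ aP ≤ i ∧ cA ≤ n - i ∧ ¬ bP ≤ i ∧ dA ≤ n - i)) ∧ ((a ≤ i ∧ ¬ cp ≤ n - i ∧ b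
    ≤ i ∧ ¬ dp ≤ n - i) ∨ (¬ a ≤ i ∧ cp ≤ n - i ∧ ¬ b ≤ i ∧ dp ≤ n - i)) := by omega

/-- Family-3 kind-b witness: a kind-a bad term of family 2 comes with good terms of families 1 and 3. [this work] -/
theorem la3 {i k : ℕ} (hs : (ap ≤ aP ∧ aP ≤ a ∧ ap ≤ aA ∧ aA ≤ a ∧ cp ≤ cP ∧ cP ≤ c ∧ cp ≤ cA ∧ cA ≤ c ∧ bp ≤ bP ∧ bP ≤ b ∧ bp ≤ bA ∧ bA ≤ b ∧ dp
    ≤ dP ∧ dP ≤ d ∧ dp ≤ dA ∧ dA ≤ d)) (hk : (¬ aP ≤ k ∧ cA ≤ n - k ∧ bP ≤ k ∧ ¬ dA ≤ n - k)) (hi : (a ≤ i ∧ ¬ cp ≤ n - i ∧ ¬ b ≤ i ∧ dp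
    ≤ n - i)) : ((ap ≤ i ∧ ¬ c ≤ n - i ∧ bp ≤ i ∧ ¬ d ≤ n - i) ∨ (¬ ap ≤ i ∧ c ≤ n - i ∧ ¬ bp ≤ i ∧ d ≤ n - i)) ∧ ((aP ≤ i ∧ ¬ cA ≤ n - i ∧ bP ≤ i
    ∧ ¬ dA ≤ n - i) ∨ (¬ aP ≤ i ∧ cA ≤ n - i ∧ ¬ bP ≤ i ∧ dA ≤ n - i)) := by omega

/-- Family-3 kind-b witness: a kind-a bad term of family 4 comes with a good term of family 2 or 1. [this work] -/
theorem la4 {i k : ℕ} (hs : (ap ≤ aP ∧ aP ≤ a ∧ ap ≤ aA ∧ aA ≤ a ∧ cp ≤ cP ∧ cP ≤ c ∧ cp ≤ cA ∧ cA ≤ c ∧ bp ≤ bP ∧ bP ≤ b ∧ bp ≤ bA ∧ bA ≤ b ∧ dp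
    ≤ dP ∧ dP ≤ d ∧ dp ≤ dA ∧ dA ≤ d)) (hp : (1 ≤ ap ∧ 1 ≤ cp ∧ 1 ≤ bp ∧ 1 ≤ dp)) (hk : (¬ aP ≤ k ∧ cA ≤ n - k ∧ bP ≤ k ∧ ¬ dA ≤ n - k)) (hi : (aA
    ≤ i ∧ ¬ cP ≤ n - i ∧ ¬ bA ≤ i ∧ dP ≤ n - i)) : ((a ≤ i ∧ ¬ cp ≤ n - i ∧ b ≤ i ∧ ¬ dp ≤ n - i) ∨ (¬ a ≤ i ∧ cp ≤ n - i ∧ ¬ b ≤ i ∧ dp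
    ≤ n - i)) ∨ ((ap ≤ i ∧ ¬ c ≤ n - i ∧ bp ≤ i ∧ ¬ d ≤ n - i) ∨ (¬ ap ≤ i ∧ c ≤ n - i ∧ ¬ bp ≤ i ∧ d ≤ n - i)) := by omega

/-- A kind-b bad term of family 4 excludes kind-a bad terms of family 4 everywhere. [this work] -/
theorem lb1 {i k : ℕ} (hk : (¬ aA ≤ k ∧ cP ≤ n - k ∧ bA ≤ k ∧ ¬ dP ≤ n - k)) : ¬ (aA ≤ i ∧ ¬ cP ≤ n - i ∧ ¬ bA ≤ i ∧ dP ≤ n - i) := by omega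

/-- Family-4 kind-b witness: a kind-a bad term of family 1 comes with good terms of families 4 and 2. [this work] -/
theorem lb2 {i k : ℕ} (hs : (ap ≤ aP ∧ aP ≤ a ∧ ap ≤ aA ∧ aA ≤ a ∧ cp ≤ cP ∧ cP ≤ c ∧ cp ≤ cA ∧ cA ≤ c ∧ bp ≤ bP ∧ bP ≤ b ∧ bp ≤ bA ∧ bA ≤ b ∧ dp
    ≤ dP ∧ dP ≤ d ∧ dp ≤ dA ∧ dA ≤ d)) (hk : (¬ aA ≤ k ∧ cP ≤ n - k ∧ bA ≤ k ∧ ¬ dP ≤ n - k)) (hi : (ap ≤ i ∧ ¬ c ≤ n - i ∧ ¬ bp ≤ i ∧ d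
    ≤ n - i)) : ((aA ≤ i ∧ ¬ cP ≤ n - i ∧ bA ≤ i ∧ ¬ dP ≤ n - i) ∨ (¬ aA ≤ i ∧ cP ≤ n - i ∧ ¬ bA ≤ i ∧ dP ≤ n - i)) ∧ ((a ≤ i ∧ ¬ cp ≤ n - i ∧ b
    ≤ i ∧ ¬ dp ≤ n - i) ∨ (¬ a ≤ i ∧ cp ≤ n - i ∧ ¬ b ≤ i ∧ dp ≤ n - i)) := by omega

/-- Family-4 kind-b witness: a kind-a bad term of family 2 comes with good terms of families 1 and 4. [this work] -/
theorem lb3 {i k : ℕ} (hs : (ap ≤ aP ∧ aP ≤ a ∧ ap ≤ aA ∧ aA ≤ a ∧ cp ≤ cP ∧ cP ≤ c ∧ cp ≤ cA ∧ cA ≤ c ∧ bp ≤ bP ∧ bP ≤ b ∧ bp ≤ bA ∧ bA ≤ b ∧ dp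
    ≤ dP ∧ dP ≤ d ∧ dp ≤ dA ∧ dA ≤ d)) (hk : (¬ aA ≤ k ∧ cP ≤ n - k ∧ bA ≤ k ∧ ¬ dP ≤ n - k)) (hi : (a ≤ i ∧ ¬ cp ≤ n - i ∧ ¬ b ≤ i ∧ dp
    ≤ n - i)) : ((ap ≤ i ∧ ¬ c ≤ n - i ∧ bp ≤ i ∧ ¬ d ≤ n - i) ∨ (¬ ap ≤ i ∧ c ≤ n - i ∧ ¬ bp ≤ i ∧ d ≤ n - i)) ∧ ((aA ≤ i ∧ ¬ cP ≤ n - i ∧ bA ≤ i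
    ∧ ¬ dP ≤ n - i) ∨ (¬ aA ≤ i ∧ cP ≤ n - i ∧ ¬ bA ≤ i ∧ dP ≤ n - i)) := by omega

/-- Family-4 kind-b witness: a kind-a bad term of family 3 comes with a good term of family 2 or 1. [this work] -/
theorem lb4 {i k : ℕ} (hs : (ap ≤ aP ∧ aP ≤ a ∧ ap ≤ aA ∧ aA ≤ a ∧ cp ≤ cP ∧ cP ≤ c ∧ cp ≤ cA ∧ cA ≤ c ∧ bp ≤ bP ∧ bP ≤ b ∧ bp ≤ bA ∧ bA ≤ b ∧ dp
    ≤ dP ∧ dP ≤ d ∧ dp ≤ dA ∧ dA ≤ d)) (hp : (1 ≤ ap ∧ 1 ≤ cp ∧ 1 ≤ bp ∧ 1 ≤ dp)) (hk : (¬ aA ≤ k ∧ cP ≤ n - k ∧ bA ≤ k ∧ ¬ dP ≤ n - k)) (hi : (aP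
    ≤ i ∧ ¬ cA ≤ n - i ∧ ¬ bP ≤ i ∧ dA ≤ n - i)) : ((a ≤ i ∧ ¬ cp ≤ n - i ∧ b ≤ i ∧ ¬ dp ≤ n - i) ∨ (¬ a ≤ i ∧ cp ≤ n - i ∧ ¬ b ≤ i ∧ dp
    ≤ n - i)) ∨ ((ap ≤ i ∧ ¬ c ≤ n - i ∧ bp ≤ i ∧ ¬ d ≤ n - i) ∨ (¬ ap ≤ i ∧ c ≤ n - i ∧ ¬ bp ≤ i ∧ d ≤ n - i)) := by omega

/-- A kind-b bad term of family 1 excludes kind-a bad terms of family 1 everywhere. [this work] -/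
theorem lc1 {i k : ℕ} (hk : (¬ ap ≤ k ∧ c ≤ n - k ∧ bp ≤ k ∧ ¬ d ≤ n - k)) : ¬ (ap ≤ i ∧ ¬ c ≤ n - i ∧ ¬ bp ≤ i ∧ d ≤ n - i) := by omega

/-- A kind-b bad term of family 2 excludes kind-a bad terms of family 2 everywhere. [this work] -/
theorem lc2 {i k : ℕ} (hk : (¬ a ≤ k ∧ cp ≤ n - k ∧ b ≤ k ∧ ¬ dp ≤ n - k)) : ¬ (a ≤ i ∧ ¬ cp ≤ n - i ∧ ¬ b ≤ i ∧ dp ≤ n - i) := by omega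

/-- Family-2 kind-b witness: a kind-a bad term of family 3 comes with a good term of family 2. [this work] -/
theorem lc3 {i k : ℕ} (hs : (ap ≤ aP ∧ aP ≤ a ∧ ap ≤ aA ∧ aA ≤ a ∧ cp ≤ cP ∧ cP ≤ c ∧ cp ≤ cA ∧ cA ≤ c ∧ bp ≤ bP ∧ bP ≤ b ∧ bp ≤ bA ∧ bA ≤ b ∧ dp
    ≤ dP ∧ dP ≤ d ∧ dp ≤ dA ∧ dA ≤ d)) (hk : (¬ a ≤ k ∧ cp ≤ n - k ∧ b ≤ k ∧ ¬ dp ≤ n - k)) (hi : (aP ≤ i ∧ ¬ cA ≤ n - i ∧ ¬ bP ≤ i ∧ dA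
    ≤ n - i)) : ((a ≤ i ∧ ¬ cp ≤ n - i ∧ b ≤ i ∧ ¬ dp ≤ n - i) ∨ (¬ a ≤ i ∧ cp ≤ n - i ∧ ¬ b ≤ i ∧ dp ≤ n - i)) := by omega

/-- Family-1 kind-b witness: a kind-a bad term of family 3 comes with a good term of family 1. [this work] -/
theorem lc4 {i k : ℕ} (hs : (ap ≤ aP ∧ aP ≤ a ∧ ap ≤ aA ∧ aA ≤ a ∧ cp ≤ cP ∧ cP ≤ c ∧ cp ≤ cA ∧ cA ≤ c ∧ bp ≤ bP ∧ bP ≤ b ∧ bp ≤ bA ∧ bA ≤ b ∧ dp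
    ≤ dP ∧ dP ≤ d ∧ dp ≤ dA ∧ dA ≤ d)) (hk : (¬ ap ≤ k ∧ c ≤ n - k ∧ bp ≤ k ∧ ¬ d ≤ n - k)) (hi : (aP ≤ i ∧ ¬ cA ≤ n - i ∧ ¬ bP ≤ i ∧ dA
    ≤ n - i)) : ((ap ≤ i ∧ ¬ c ≤ n - i ∧ bp ≤ i ∧ ¬ d ≤ n - i) ∨ (¬ ap ≤ i ∧ c ≤ n - i ∧ ¬ bp ≤ i ∧ d ≤ n - i)) := by omega

/-- Family-2 kind-b witness: a kind-a bad term of family 4 comes with a good term of family 2. [this work] -/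
theorem lc5 {i k : ℕ} (hs : (ap ≤ aP ∧ aP ≤ a ∧ ap ≤ aA ∧ aA ≤ a ∧ cp ≤ cP ∧ cP ≤ c ∧ cp ≤ cA ∧ cA ≤ c ∧ bp ≤ bP ∧ bP ≤ b ∧ bp ≤ bA ∧ bA ≤ b ∧ dp
    ≤ dP ∧ dP ≤ d ∧ dp ≤ dA ∧ dA ≤ d)) (hk : (¬ a ≤ k ∧ cp ≤ n - k ∧ b ≤ k ∧ ¬ dp ≤ n - k)) (hi : (aA ≤ i ∧ ¬ cP ≤ n - i ∧ ¬ bA ≤ i ∧ dP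
    ≤ n - i)) : ((a ≤ i ∧ ¬ cp ≤ n - i ∧ b ≤ i ∧ ¬ dp ≤ n - i) ∨ (¬ a ≤ i ∧ cp ≤ n - i ∧ ¬ b ≤ i ∧ dp ≤ n - i)) := by omega

/-- Family-1 kind-b witness: a kind-a bad term of family 4 comes with a good term of family 1. [this work] -/
theorem lc6 {i k : ℕ} (hs : (ap ≤ aP ∧ aP ≤ a ∧ ap ≤ aA ∧ aA ≤ a ∧ cp ≤ cP ∧ cP ≤ c ∧ cp ≤ cA ∧ cA ≤ c ∧ bp ≤ bP ∧ bP ≤ b ∧ bp ≤ bA ∧ bA ≤ b ∧ dp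
    ≤ dP ∧ dP ≤ d ∧ dp ≤ dA ∧ dA ≤ d)) (hk : (¬ ap ≤ k ∧ c ≤ n - k ∧ bp ≤ k ∧ ¬ d ≤ n - k)) (hi : (aA ≤ i ∧ ¬ cP ≤ n - i ∧ ¬ bA ≤ i ∧ dP
    ≤ n - i)) : ((ap ≤ i ∧ ¬ c ≤ n - i ∧ bp ≤ i ∧ ¬ d ≤ n - i) ∨ (¬ ap ≤ i ∧ c ≤ n - i ∧ ¬ bp ≤ i ∧ d ≤ n - i)) := by omega

/-- Any kind-a bad term anywhere makes every kind-b bad term of family 2 come with a good term of family 1. [this work] -/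
theorem ld1 {i k : ℕ} (hs : (ap ≤ aP ∧ aP ≤ a ∧ ap ≤ aA ∧ aA ≤ a ∧ cp ≤ cP ∧ cP ≤ c ∧ cp ≤ cA ∧ cA ≤ c ∧ bp ≤ bP ∧ bP ≤ b ∧ bp ≤ bA ∧ bA ≤ b ∧ dp
    ≤ dP ∧ dP ≤ d ∧ dp ≤ dA ∧ dA ≤ d)) (hp : (1 ≤ ap ∧ 1 ≤ cp ∧ 1 ≤ bp ∧ 1 ≤ dp)) (hi : (ap ≤ i ∧ ¬ c ≤ n - i ∧ ¬ bp ≤ i ∧ d ≤ n - i) ∨ (a ≤ i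
    ∧ ¬ cp ≤ n - i ∧ ¬ b ≤ i ∧ dp ≤ n - i) ∨ (aP ≤ i ∧ ¬ cA ≤ n - i ∧ ¬ bP ≤ i ∧ dA ≤ n - i) ∨ (aA ≤ i ∧ ¬ cP ≤ n - i ∧ ¬ bA ≤ i ∧ dP
    ≤ n - i)) (hk : (¬ a ≤ k ∧ cp ≤ n - k ∧ b ≤ k ∧ ¬ dp ≤ n - k)) : ((ap ≤ k ∧ ¬ c ≤ n - k ∧ bp ≤ k ∧ ¬ d ≤ n - k) ∨ (¬ ap ≤ k ∧ c ≤ n - k ∧ ¬ bp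
    ≤ k ∧ d ≤ n - k)) := by
  omega

/-- Any kind-a bad term anywhere makes every kind-b bad term of family 1 come with a good term of family 2. [this work] -/
theorem ld2 {i k : ℕ} (hs : (ap ≤ aP ∧ aP ≤ a ∧ ap ≤ aA ∧ aA ≤ a ∧ cp ≤ cP ∧ cP ≤ c ∧ cp ≤ cA ∧ cA ≤ c ∧ bp ≤ bP ∧ bP ≤ b ∧ bp ≤ bA ∧ bA ≤ b ∧ dp
    ≤ dP ∧ dP ≤ d ∧ dp ≤ dA ∧ dA ≤ d)) (hp : (1 ≤ ap ∧ 1 ≤ cp ∧ 1 ≤ bp ∧ 1 ≤ dp)) (hi : (ap ≤ i ∧ ¬ c ≤ n - i ∧ ¬ bp ≤ i ∧ d ≤ n - i) ∨ (a ≤ i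
    ∧ ¬ cp ≤ n - i ∧ ¬ b ≤ i ∧ dp ≤ n - i) ∨ (aP ≤ i ∧ ¬ cA ≤ n - i ∧ ¬ bP ≤ i ∧ dA ≤ n - i) ∨ (aA ≤ i ∧ ¬ cP ≤ n - i ∧ ¬ bA ≤ i ∧ dP
    ≤ n - i)) (hk : (¬ ap ≤ k ∧ c ≤ n - k ∧ bp ≤ k ∧ ¬ d ≤ n - k)) : ((a ≤ k ∧ ¬ cp ≤ n - k ∧ b ≤ k ∧ ¬ dp ≤ n - k) ∨ (¬ a ≤ k ∧ cp ≤ n - k ∧ ¬ b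
    ≤ k ∧ dp ≤ n - k)) := by
  omega

/-- With a kind-b bad term of family 3 somewhere, at every position the kind-a bad terms are outnumbered by the good terms. [this work] -/
theorem domA3 {k : ℕ} (hs : (ap ≤ aP ∧ aP ≤ a ∧ ap ≤ aA ∧ aA ≤ a ∧ cp ≤ cP ∧ cP ≤ c ∧ cp ≤ cA ∧ cA ≤ c ∧ bp ≤ bP ∧ bP ≤ b ∧ bp ≤ bA ∧ bA ≤ b ∧ dp
    ≤ dP ∧ dP ≤ d ∧ dp ≤ dA ∧ dA ≤ d)) (hp : (1 ≤ ap ∧ 1 ≤ cp ∧ 1 ≤ bp ∧ 1 ≤ dp)) (hk : (¬ aP ≤ k ∧ cA ≤ n - k ∧ bP ≤ k ∧ ¬ dA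
    ≤ n - k)) (i : ℕ) : ((if (ap ≤ i ∧ ¬ c ≤ n - i ∧ ¬ bp ≤ i ∧ d ≤ n - i) then 1 else 0) + (if (a ≤ i ∧ ¬ cp ≤ n - i ∧ ¬ b ≤ i ∧ dp
    ≤ n - i) then 1 else 0) + (if (aP ≤ i ∧ ¬ cA ≤ n - i ∧ ¬ bP ≤ i ∧ dA ≤ n - i) then 1 else 0) + (if (aA ≤ i ∧ ¬ cP ≤ n - i ∧ ¬ bA ≤ i ∧ dP
    ≤ n - i) then 1 else 0)) ≤ ((if ((ap ≤ i ∧ ¬ c ≤ n - i ∧ bp ≤ i ∧ ¬ d ≤ n - i) ∨ (¬ ap ≤ i ∧ c ≤ n - i ∧ ¬ bp ≤ i ∧ d ≤ n - i)) then 1 else 0)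
    + (if ((a ≤ i ∧ ¬ cp ≤ n - i ∧ b ≤ i ∧ ¬ dp ≤ n - i) ∨ (¬ a ≤ i ∧ cp ≤ n - i ∧ ¬ b ≤ i ∧ dp ≤ n - i)) then 1 else 0) + (if ((aP ≤ i ∧ ¬ cA
    ≤ n - i ∧ bP ≤ i ∧ ¬ dA ≤ n - i) ∨ (¬ aP ≤ i ∧ cA ≤ n - i ∧ ¬ bP ≤ i ∧ dA ≤ n - i)) then 1 else 0) + (if ((aA ≤ i ∧ ¬ cP ≤ n - i ∧ bA ≤ i
    ∧ ¬ dP ≤ n - i) ∨ (¬ aA ≤ i ∧ cP ≤ n - i ∧ ¬ bA ≤ i ∧ dP ≤ n - i)) then 1 else 0)) := by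
  have n3 : ¬ (aP ≤ i ∧ ¬ cA ≤ n - i ∧ ¬ bP ≤ i ∧ dA ≤ n - i) := la1 hk
  have u4 : (if (aA ≤ i ∧ ¬ cP ≤ n - i ∧ ¬ bA ≤ i ∧ dP ≤ n - i) then 1 else 0) ≤ 1 := by split <;> omega
  by_cases h1 : (ap ≤ i ∧ ¬ c ≤ n - i ∧ ¬ bp ≤ i ∧ d ≤ n - i)
  · obtain ⟨g3, g2⟩ := la2 hs hk h1
    have n2 : ¬ (a ≤ i ∧ ¬ cp ≤ n - i ∧ ¬ b ≤ i ∧ dp ≤ n - i) := by omega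
    rw [if_pos h1, if_neg n2, if_neg n3, if_pos g2, if_pos g3]
    omega
  · by_cases h2 : (a ≤ i ∧ ¬ cp ≤ n - i ∧ ¬ b ≤ i ∧ dp ≤ n - i)
    · obtain ⟨g1, g3⟩ := la3 hs hk h2
      rw [if_neg h1, if_pos h2, if_neg n3, if_pos g1, if_pos g3]
      omega
    · by_cases h4 : (aA ≤ i ∧ ¬ cP ≤ n - i ∧ ¬ bA ≤ i ∧ dP ≤ n - i)
      · rw [if_neg h1, if_neg h2, if_neg n3, if_pos h4]
        rcases la4 hs hp hk h4 with g | g <;> rw [if_pos g] <;> omega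
      · rw [if_neg h1, if_neg h2, if_neg n3, if_neg h4]
        omega

/-- With a kind-b bad term of family 4 somewhere, at every position the kind-a bad terms are outnumbered by the good terms. [this work] -/
theorem domA4 {k : ℕ} (hs : (ap ≤ aP ∧ aP ≤ a ∧ ap ≤ aA ∧ aA ≤ a ∧ cp ≤ cP ∧ cP ≤ c ∧ cp ≤ cA ∧ cA ≤ c ∧ bp ≤ bP ∧ bP ≤ b ∧ bp ≤ bA ∧ bA ≤ b ∧ dp
    ≤ dP ∧ dP ≤ d ∧ dp ≤ dA ∧ dA ≤ d)) (hp : (1 ≤ ap ∧ 1 ≤ cp ∧ 1 ≤ bp ∧ 1 ≤ dp)) (hk : (¬ aA ≤ k ∧ cP ≤ n - k ∧ bA ≤ k ∧ ¬ dP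
    ≤ n - k)) (i : ℕ) : ((if (ap ≤ i ∧ ¬ c ≤ n - i ∧ ¬ bp ≤ i ∧ d ≤ n - i) then 1 else 0) + (if (a ≤ i ∧ ¬ cp ≤ n - i ∧ ¬ b ≤ i ∧ dp
    ≤ n - i) then 1 else 0) + (if (aP ≤ i ∧ ¬ cA ≤ n - i ∧ ¬ bP ≤ i ∧ dA ≤ n - i) then 1 else 0) + (if (aA ≤ i ∧ ¬ cP ≤ n - i ∧ ¬ bA ≤ i ∧ dP
    ≤ n - i) then 1 else 0)) ≤ ((if ((ap ≤ i ∧ ¬ c ≤ n - i ∧ bp ≤ i ∧ ¬ d ≤ n - i) ∨ (¬ ap ≤ i ∧ c ≤ n - i ∧ ¬ bp ≤ i ∧ d ≤ n - i)) then 1 else 0)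
    + (if ((a ≤ i ∧ ¬ cp ≤ n - i ∧ b ≤ i ∧ ¬ dp ≤ n - i) ∨ (¬ a ≤ i ∧ cp ≤ n - i ∧ ¬ b ≤ i ∧ dp ≤ n - i)) then 1 else 0) + (if ((aP ≤ i ∧ ¬ cA
    ≤ n - i ∧ bP ≤ i ∧ ¬ dA ≤ n - i) ∨ (¬ aP ≤ i ∧ cA ≤ n - i ∧ ¬ bP ≤ i ∧ dA ≤ n - i)) then 1 else 0) + (if ((aA ≤ i ∧ ¬ cP ≤ n - i ∧ bA ≤ i
    ∧ ¬ dP ≤ n - i) ∨ (¬ aA ≤ i ∧ cP ≤ n - i ∧ ¬ bA ≤ i ∧ dP ≤ n - i)) then 1 else 0)) := by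
  have n4 : ¬ (aA ≤ i ∧ ¬ cP ≤ n - i ∧ ¬ bA ≤ i ∧ dP ≤ n - i) := lb1 hk
  have u3 : (if (aP ≤ i ∧ ¬ cA ≤ n - i ∧ ¬ bP ≤ i ∧ dA ≤ n - i) then 1 else 0) ≤ 1 := by split <;> omega
  by_cases h1 : (ap ≤ i ∧ ¬ c ≤ n - i ∧ ¬ bp ≤ i ∧ d ≤ n - i)
  · obtain ⟨g4, g2⟩ := lb2 hs hk h1
    have n2 : ¬ (a ≤ i ∧ ¬ cp ≤ n - i ∧ ¬ b ≤ i ∧ dp ≤ n - i) := by omega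
    rw [if_pos h1, if_neg n2, if_neg n4, if_pos g2, if_pos g4]
    omega
  · by_cases h2 : (a ≤ i ∧ ¬ cp ≤ n - i ∧ ¬ b ≤ i ∧ dp ≤ n - i)
    · obtain ⟨g1, g4⟩ := lb3 hs hk h2
      rw [if_neg h1, if_pos h2, if_neg n4, if_pos g1, if_pos g4]
      omega
    · by_cases h3 : (aP ≤ i ∧ ¬ cA ≤ n - i ∧ ¬ bP ≤ i ∧ dA ≤ n - i)
      · rw [if_neg h1, if_neg h2, if_pos h3, if_neg n4]
        rcases lb4 hs hp hk h3 with g | g <;> rw [if_pos g] <;> omega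
      · rw [if_neg h1, if_neg h2, if_neg h3, if_neg n4]
        omega

/-- With kind-b bad terms of both families 1 and 2 somewhere, at every position the kind-a bad terms are outnumbered by the good terms. [this work] -/
theorem domA12 {k1 k2 : ℕ} (hs : (ap ≤ aP ∧ aP ≤ a ∧ ap ≤ aA ∧ aA ≤ a ∧ cp ≤ cP ∧ cP ≤ c ∧ cp ≤ cA ∧ cA ≤ c ∧ bp ≤ bP ∧ bP ≤ b ∧ bp ≤ bA ∧ bA ≤ b
    ∧ dp ≤ dP ∧ dP ≤ d ∧ dp ≤ dA ∧ dA ≤ d)) (hk1 : (¬ ap ≤ k1 ∧ c ≤ n - k1 ∧ bp ≤ k1 ∧ ¬ d ≤ n - k1)) (hk2 : (¬ a ≤ k2 ∧ cp ≤ n - k2 ∧ b ≤ k2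
    ∧ ¬ dp ≤ n - k2)) (i : ℕ) : ((if (ap ≤ i ∧ ¬ c ≤ n - i ∧ ¬ bp ≤ i ∧ d ≤ n - i) then 1 else 0) + (if (a ≤ i ∧ ¬ cp ≤ n - i ∧ ¬ b ≤ i ∧ dp
    ≤ n - i) then 1 else 0) + (if (aP ≤ i ∧ ¬ cA ≤ n - i ∧ ¬ bP ≤ i ∧ dA ≤ n - i) then 1 else 0) + (if (aA ≤ i ∧ ¬ cP ≤ n - i ∧ ¬ bA ≤ i ∧ dP
    ≤ n - i) then 1 else 0)) ≤ ((if ((ap ≤ i ∧ ¬ c ≤ n - i ∧ bp ≤ i ∧ ¬ d ≤ n - i) ∨ (¬ ap ≤ i ∧ c ≤ n - i ∧ ¬ bp ≤ i ∧ d ≤ n - i)) then 1 else 0)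
    + (if ((a ≤ i ∧ ¬ cp ≤ n - i ∧ b ≤ i ∧ ¬ dp ≤ n - i) ∨ (¬ a ≤ i ∧ cp ≤ n - i ∧ ¬ b ≤ i ∧ dp ≤ n - i)) then 1 else 0) + (if ((aP ≤ i ∧ ¬ cA
    ≤ n - i ∧ bP ≤ i ∧ ¬ dA ≤ n - i) ∨ (¬ aP ≤ i ∧ cA ≤ n - i ∧ ¬ bP ≤ i ∧ dA ≤ n - i)) then 1 else 0) + (if ((aA ≤ i ∧ ¬ cP ≤ n - i ∧ bA ≤ i
    ∧ ¬ dP ≤ n - i) ∨ (¬ aA ≤ i ∧ cP ≤ n - i ∧ ¬ bA ≤ i ∧ dP ≤ n - i)) then 1 else 0)) := by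
  have n1 : ¬ (ap ≤ i ∧ ¬ c ≤ n - i ∧ ¬ bp ≤ i ∧ d ≤ n - i) := lc1 hk1
  have n2 : ¬ (a ≤ i ∧ ¬ cp ≤ n - i ∧ ¬ b ≤ i ∧ dp ≤ n - i) := lc2 hk2
  have u3 : (if (aP ≤ i ∧ ¬ cA ≤ n - i ∧ ¬ bP ≤ i ∧ dA ≤ n - i) then 1 else 0) ≤ 1 := by split <;> omega
  have u4 : (if (aA ≤ i ∧ ¬ cP ≤ n - i ∧ ¬ bA ≤ i ∧ dP ≤ n - i) then 1 else 0) ≤ 1 := by split <;> omega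
  rw [if_neg n1, if_neg n2]
  by_cases h3 : (aP ≤ i ∧ ¬ cA ≤ n - i ∧ ¬ bP ≤ i ∧ dA ≤ n - i)
  · rw [if_pos (lc4 hs hk1 h3), if_pos (lc3 hs hk2 h3)]
    omega
  · by_cases h4 : (aA ≤ i ∧ ¬ cP ≤ n - i ∧ ¬ bA ≤ i ∧ dP ≤ n - i)
    · rw [if_pos (lc6 hs hk1 h4), if_pos (lc5 hs hk2 h4)]
      omega
    · rw [if_neg h3, if_neg h4]
      omega

/-- If the kind-b bad terms are all of family 2 and some kind-a bad term exists, every kind-b bad term is cancelled by a good term of family 1.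
[this work] -/
theorem domB2 {i0 : ℕ} (hs : (ap ≤ aP ∧ aP ≤ a ∧ ap ≤ aA ∧ aA ≤ a ∧ cp ≤ cP ∧ cP ≤ c ∧ cp ≤ cA ∧ cA ≤ c ∧ bp ≤ bP ∧ bP ≤ b ∧ bp ≤ bA ∧ bA ≤ b ∧ dp
    ≤ dP ∧ dP ≤ d ∧ dp ≤ dA ∧ dA ≤ d)) (hp : (1 ≤ ap ∧ 1 ≤ cp ∧ 1 ≤ bp ∧ 1 ≤ dp)) (ha : (ap ≤ i0 ∧ ¬ c ≤ n - i0 ∧ ¬ bp ≤ i0 ∧ d ≤ n - i0) ∨ (a ≤ i0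
    ∧ ¬ cp ≤ n - i0 ∧ ¬ b ≤ i0 ∧ dp ≤ n - i0) ∨ (aP ≤ i0 ∧ ¬ cA ≤ n - i0 ∧ ¬ bP ≤ i0 ∧ dA ≤ n - i0) ∨ (aA ≤ i0 ∧ ¬ cP ≤ n - i0 ∧ ¬ bA ≤ i0 ∧ dP
    ≤ n - i0)) (h1 : ∀ k, ¬ (¬ ap ≤ k ∧ c ≤ n - k ∧ bp ≤ k ∧ ¬ d ≤ n - k))
    (h3 : ∀ k, ¬ (¬ aP ≤ k ∧ cA ≤ n - k ∧ bP ≤ k ∧ ¬ dA ≤ n - k)) (h4 : ∀ k, ¬ (¬ aA ≤ k ∧ cP ≤ n - k ∧ bA ≤ k ∧ ¬ dP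
        ≤ n - k)) (k : ℕ) : ((if (¬ ap ≤ k ∧ c ≤ n - k ∧ bp ≤ k ∧ ¬ d ≤ n - k) then 1 else 0) + (if (¬ a ≤ k ∧ cp ≤ n - k ∧ b ≤ k ∧ ¬ dp
        ≤ n - k) then 1 else 0) + (if (¬ aP ≤ k ∧ cA ≤ n - k ∧ bP ≤ k ∧ ¬ dA ≤ n - k) then 1 else 0) + (if (¬ aA ≤ k ∧ cP ≤ n - k ∧ bA ≤ k ∧ ¬ dP
        ≤ n - k) then 1 else 0)) ≤ ((if ((ap ≤ k ∧ ¬ c ≤ n - k ∧ bp ≤ k ∧ ¬ d ≤ n - k) ∨ (¬ ap ≤ k ∧ c ≤ n - k ∧ ¬ bp ≤ k ∧ d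
        ≤ n - k)) then 1 else 0) + (if ((a ≤ k ∧ ¬ cp ≤ n - k ∧ b ≤ k ∧ ¬ dp ≤ n - k) ∨ (¬ a ≤ k ∧ cp ≤ n - k ∧ ¬ b ≤ k ∧ dp
        ≤ n - k)) then 1 else 0) + (if ((aP ≤ k ∧ ¬ cA ≤ n - k ∧ bP ≤ k ∧ ¬ dA ≤ n - k) ∨ (¬ aP ≤ k ∧ cA ≤ n - k ∧ ¬ bP ≤ k ∧ dA
        ≤ n - k)) then 1 else 0) + (if ((aA ≤ k ∧ ¬ cP ≤ n - k ∧ bA ≤ k ∧ ¬ dP ≤ n - k) ∨ (¬ aA ≤ k ∧ cP ≤ n - k ∧ ¬ bA ≤ k ∧ dP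
        ≤ n - k)) then 1 else 0)) := by
  rw [if_neg (h1 k), if_neg (h3 k), if_neg (h4 k)]
  by_cases h2 : (¬ a ≤ k ∧ cp ≤ n - k ∧ b ≤ k ∧ ¬ dp ≤ n - k)
  · rw [if_pos h2, if_pos (ld1 hs hp ha h2)]
    omega
  · rw [if_neg h2]
    omega

/-- If the kind-b bad terms are all of family 1 and some kind-a bad term exists, every kind-b bad term is cancelled by a good term of family 2.
[this work] -/
theorem domB1 {i0 : ℕ} (hs : (ap ≤ aP ∧ aP ≤ a ∧ ap ≤ aA ∧ aA ≤ a ∧ cp ≤ cP ∧ cP ≤ c ∧ cp ≤ cA ∧ cA ≤ c ∧ bp ≤ bP ∧ bP ≤ b ∧ bp ≤ bA ∧ bA ≤ b ∧ dp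
    ≤ dP ∧ dP ≤ d ∧ dp ≤ dA ∧ dA ≤ d)) (hp : (1 ≤ ap ∧ 1 ≤ cp ∧ 1 ≤ bp ∧ 1 ≤ dp)) (ha : (ap ≤ i0 ∧ ¬ c ≤ n - i0 ∧ ¬ bp ≤ i0 ∧ d ≤ n - i0) ∨ (a ≤ i0
    ∧ ¬ cp ≤ n - i0 ∧ ¬ b ≤ i0 ∧ dp ≤ n - i0) ∨ (aP ≤ i0 ∧ ¬ cA ≤ n - i0 ∧ ¬ bP ≤ i0 ∧ dA ≤ n - i0) ∨ (aA ≤ i0 ∧ ¬ cP ≤ n - i0 ∧ ¬ bA ≤ i0 ∧ dP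
    ≤ n - i0)) (h2 : ∀ k, ¬ (¬ a ≤ k ∧ cp ≤ n - k ∧ b ≤ k ∧ ¬ dp ≤ n - k))
    (h3 : ∀ k, ¬ (¬ aP ≤ k ∧ cA ≤ n - k ∧ bP ≤ k ∧ ¬ dA ≤ n - k)) (h4 : ∀ k, ¬ (¬ aA ≤ k ∧ cP ≤ n - k ∧ bA ≤ k ∧ ¬ dP
        ≤ n - k)) (k : ℕ) : ((if (¬ ap ≤ k ∧ c ≤ n - k ∧ bp ≤ k ∧ ¬ d ≤ n - k) then 1 else 0) + (if (¬ a ≤ k ∧ cp ≤ n - k ∧ b ≤ k ∧ ¬ dp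
        ≤ n - k) then 1 else 0) + (if (¬ aP ≤ k ∧ cA ≤ n - k ∧ bP ≤ k ∧ ¬ dA ≤ n - k) then 1 else 0) + (if (¬ aA ≤ k ∧ cP ≤ n - k ∧ bA ≤ k ∧ ¬ dP
        ≤ n - k) then 1 else 0)) ≤ ((if ((ap ≤ k ∧ ¬ c ≤ n - k ∧ bp ≤ k ∧ ¬ d ≤ n - k) ∨ (¬ ap ≤ k ∧ c ≤ n - k ∧ ¬ bp ≤ k ∧ d
        ≤ n - k)) then 1 else 0) + (if ((a ≤ k ∧ ¬ cp ≤ n - k ∧ b ≤ k ∧ ¬ dp ≤ n - k) ∨ (¬ a ≤ k ∧ cp ≤ n - k ∧ ¬ b ≤ k ∧ dp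
        ≤ n - k)) then 1 else 0) + (if ((aP ≤ k ∧ ¬ cA ≤ n - k ∧ bP ≤ k ∧ ¬ dA ≤ n - k) ∨ (¬ aP ≤ k ∧ cA ≤ n - k ∧ ¬ bP ≤ k ∧ dA
        ≤ n - k)) then 1 else 0) + (if ((aA ≤ k ∧ ¬ cP ≤ n - k ∧ bA ≤ k ∧ ¬ dP ≤ n - k) ∨ (¬ aA ≤ k ∧ cP ≤ n - k ∧ ¬ bA ≤ k ∧ dP
        ≤ n - k)) then 1 else 0)) := by
  rw [if_neg (h2 k), if_neg (h3 k), if_neg (h4 k)]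
  by_cases h1 : (¬ ap ≤ k ∧ c ≤ n - k ∧ bp ≤ k ∧ ¬ d ≤ n - k)
  · rw [if_pos h1, if_pos (ld2 hs hp ha h1)]
    omega
  · rw [if_neg h1]
    omega

/-- **Dichotomy.**  Either at every position the kind-a bad terms are outnumbered by the good terms, or at every position the kind-b bad terms
are. [this work] -/
theorem dichotomy (hs : (ap ≤ aP ∧ aP ≤ a ∧ ap ≤ aA ∧ aA ≤ a ∧ cp ≤ cP ∧ cP ≤ c ∧ cp ≤ cA ∧ cA ≤ c ∧ bp ≤ bP ∧ bP ≤ b ∧ bp ≤ bA ∧ bA ≤ b ∧ dp ≤ dP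
    ∧ dP ≤ d ∧ dp ≤ dA ∧ dA ≤ d)) (hp : (1 ≤ ap ∧ 1 ≤ cp ∧ 1 ≤ bp ∧ 1 ≤ dp)) :
    (∀ i, ((if (ap ≤ i ∧ ¬ c ≤ n - i ∧ ¬ bp ≤ i ∧ d ≤ n - i) then 1 else 0) + (if (a ≤ i ∧ ¬ cp ≤ n - i ∧ ¬ b ≤ i ∧ dp ≤ n - i) then 1 else 0)
        + (if (aP ≤ i ∧ ¬ cA ≤ n - i ∧ ¬ bP ≤ i ∧ dA ≤ n - i) then 1 else 0) + (if (aA ≤ i ∧ ¬ cP ≤ n - i ∧ ¬ bA ≤ i ∧ dP ≤ n - i) then 1 else 0))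
        ≤ ((if ((ap ≤ i ∧ ¬ c ≤ n - i ∧ bp ≤ i ∧ ¬ d ≤ n - i) ∨ (¬ ap ≤ i ∧ c ≤ n - i ∧ ¬ bp ≤ i ∧ d ≤ n - i)) then 1 else 0) + (if ((a ≤ i ∧ ¬ cp
        ≤ n - i ∧ b ≤ i ∧ ¬ dp ≤ n - i) ∨ (¬ a ≤ i ∧ cp ≤ n - i ∧ ¬ b ≤ i ∧ dp ≤ n - i)) then 1 else 0) + (if ((aP ≤ i ∧ ¬ cA ≤ n - i ∧ bP ≤ i
        ∧ ¬ dA ≤ n - i) ∨ (¬ aP ≤ i ∧ cA ≤ n - i ∧ ¬ bP ≤ i ∧ dA ≤ n - i)) then 1 else 0) + (if ((aA ≤ i ∧ ¬ cP ≤ n - i ∧ bA ≤ i ∧ ¬ dP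
        ≤ n - i) ∨ (¬ aA ≤ i ∧ cP ≤ n - i ∧ ¬ bA ≤ i ∧ dP ≤ n - i)) then 1 else 0))) ∨ (∀ k, ((if (¬ ap ≤ k ∧ c ≤ n - k ∧ bp ≤ k ∧ ¬ d
        ≤ n - k) then 1 else 0) + (if (¬ a ≤ k ∧ cp ≤ n - k ∧ b ≤ k ∧ ¬ dp ≤ n - k) then 1 else 0) + (if (¬ aP ≤ k ∧ cA ≤ n - k ∧ bP ≤ k ∧ ¬ dA
        ≤ n - k) then 1 else 0) + (if (¬ aA ≤ k ∧ cP ≤ n - k ∧ bA ≤ k ∧ ¬ dP ≤ n - k) then 1 else 0)) ≤ ((if ((ap ≤ k ∧ ¬ c ≤ n - k ∧ bp ≤ k ∧ ¬ d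
        ≤ n - k) ∨ (¬ ap ≤ k ∧ c ≤ n - k ∧ ¬ bp ≤ k ∧ d ≤ n - k)) then 1 else 0) + (if ((a ≤ k ∧ ¬ cp ≤ n - k ∧ b ≤ k ∧ ¬ dp ≤ n - k) ∨ (¬ a ≤ k
        ∧ cp ≤ n - k ∧ ¬ b ≤ k ∧ dp ≤ n - k)) then 1 else 0) + (if ((aP ≤ k ∧ ¬ cA ≤ n - k ∧ bP ≤ k ∧ ¬ dA ≤ n - k) ∨ (¬ aP ≤ k ∧ cA ≤ n - k ∧ ¬ bP
        ≤ k ∧ dA ≤ n - k)) then 1 else 0) + (if ((aA ≤ k ∧ ¬ cP ≤ n - k ∧ bA ≤ k ∧ ¬ dP ≤ n - k) ∨ (¬ aA ≤ k ∧ cP ≤ n - k ∧ ¬ bA ≤ k ∧ dP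
        ≤ n - k)) then 1 else 0))) := by
  by_cases e3 : ∃ k, (¬ aP ≤ k ∧ cA ≤ n - k ∧ bP ≤ k ∧ ¬ dA ≤ n - k)
  · obtain ⟨k, hk⟩ := e3
    exact Or.inl (domA3 hs hp hk)
  by_cases e4 : ∃ k, (¬ aA ≤ k ∧ cP ≤ n - k ∧ bA ≤ k ∧ ¬ dP ≤ n - k)
  · obtain ⟨k, hk⟩ := e4
    exact Or.inl (domA4 hs hp hk)
  have n3 := not_exists.mp e3
  have n4 := not_exists.mp e4
  by_cases ea : ∃ i, (ap ≤ i ∧ ¬ c ≤ n - i ∧ ¬ bp ≤ i ∧ d ≤ n - i) ∨ (a ≤ i ∧ ¬ cp ≤ n - i ∧ ¬ b ≤ i ∧ dp ≤ n - i) ∨ (aP ≤ i ∧ ¬ cA ≤ n - i ∧ ¬ bP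
      ≤ i ∧ dA ≤ n - i) ∨ (aA ≤ i ∧ ¬ cP ≤ n - i ∧ ¬ bA ≤ i ∧ dP ≤ n - i)
  · obtain ⟨i0, ha⟩ := ea
    by_cases e1 : ∃ k, (¬ ap ≤ k ∧ c ≤ n - k ∧ bp ≤ k ∧ ¬ d ≤ n - k)
    · by_cases e2 : ∃ k, (¬ a ≤ k ∧ cp ≤ n - k ∧ b ≤ k ∧ ¬ dp ≤ n - k)
      · obtain ⟨k1, hk1⟩ := e1
        obtain ⟨k2, hk2⟩ := e2
        exact Or.inl (domA12 hs hk1 hk2)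
      · exact Or.inr (domB1 hs hp ha (not_exists.mp e2) n3 n4)
    · exact Or.inr (domB2 hs hp ha (not_exists.mp e1) n3 n4)
  · refine Or.inl fun i => ?_
    have hn := not_exists.mp ea i
    have m1 : ¬ (ap ≤ i ∧ ¬ c ≤ n - i ∧ ¬ bp ≤ i ∧ d ≤ n - i) := fun h => hn (Or.inl h)
    have m2 : ¬ (a ≤ i ∧ ¬ cp ≤ n - i ∧ ¬ b ≤ i ∧ dp ≤ n - i) := fun h => hn (Or.inr (Or.inl h))
    have m3 : ¬ (aP ≤ i ∧ ¬ cA ≤ n - i ∧ ¬ bP ≤ i ∧ dA ≤ n - i) := fun h => hn (Or.inr (Or.inr (Or.inl h)))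
    have m4 : ¬ (aA ≤ i ∧ ¬ cP ≤ n - i ∧ ¬ bA ≤ i ∧ dP ≤ n - i) := fun h => hn (Or.inr (Or.inr (Or.inr h)))
    rw [if_neg m1, if_neg m2, if_neg m3, if_neg m4]
    omega

end Main

end LamCount

end Antithetic

end Summit.CriticalPhenomena.PercolationContinuityZ3.Theorems
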